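import Summits.CriticalPhenomena.PercolationContinuityZ3.Theorems.PercNearOneGluingNoHeavyQuantChemicalRadiusCritical
import Literature.Probability.Percolation.HutchcroftVolumeTailSubcritical
import HarnessLib

/-!
# THE SUBCRITICAL SIDE OF THE CHEMICAL WINDOW: under the triangle condition `P_p(Rad_int(C(0)) ≥ r) ≤ C/r` UNIFORMLY in
# `p ≤ p_c` (Kozma–Nachmias' recursion run at `p`), hence with the hypothesis-free floor `(p/p_c)^r/(e(r+3))`:
# `P_p(Rad_int(C(0)) ≥ r) ≍ 1/r` throughout the subcritical window `r(p_c − p) ≤ p_c` — quant lane, seat p4 gen 38, file 7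

builds on p205010 (kernel theorem, internal audit signed; external expert review pending) — NOT used in this file.
Seat `prim-quant-p4`, `--supports stmt-CriticalPhenomena-4575`; pure proofs, no definitions.

`far ℤ^d 0 r = {Rad_int(C(0)) ≥ r}` (`Chemical.far`), `Γ_p(r) = armSup d p r` (Kozma–Nachmias' supremum over step graphs), `p_c = criticalProbI d`.

* §1 **`ChemRad.armSup_le_of_triangle_subcritical`** — `TriangleCondition d` ⟹ `∃ C > 0, ∀ p ≤ p_c, ∀ r ≥ 1, Γ_p(r) ≤ C/r`: the
  mean-field volume tail `P_{p_c}(|C| ≥ k) ≤ A k^{-1/2}` (tree, `exponents_of_triangle`) bounds `P_p(|C| ≥ k)` for every `p ≤ p_c`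
  (monotonicity), and Kozma–Nachmias' recursion (tree, `Quant.chemicalArm_powerLaw_of_volumeTail`, valid at EVERY `p`) gives the same
  constant for all `p ≤ p_c` (Hutchcroft 2022, proof of Lemma 2.1: "`P^H_p(R_v ≥ r) ⪯ r^{-1}` for every `0 ≤ p ≤ p_c`").
  **`ChemRad.real_far_le_of_triangle_subcritical`** — the same for `P_p(far ℤ^d 0 r)`.
* §2 **`ChemRad.real_far_subcrit_window_two_sided_of_triangle`** — for `0 < p ≤ p_c` with `r(p_c − p) ≤ p` (the subcritical LINEAR
  window) and `r ≥ 1`: `1/(e²(r+3)) ≤ P_p(Rad_int(C(0)) ≥ r) ≤ C/r` (lower: file 3's `(p/p_c)^r/(e(r+3))` with `(p/p_c)^r ≥ e^{-r(p_c−p)/p} ≥ e^{-1}`;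
  hypothesis-free); **`…_high_dim`** — unconditionally for `d ≥ D`.  With file 5's supercritical window this completes:
  **in high dimensions the chemical one-arm probability is `≍ 1/r` throughout `|p − p_c| ≲ 1/r`, `≍ (p − p_c)` above it, and decays at
  least like `e^{−r(p_c−p)/p}/r` (and in truth exponentially) below it.**

HONEST STATUS.  §1 is Kozma–Nachmias 2009 Thm 1.2(ii)'s upper bound read at `p ≤ p_c` (printed remark in Hutchcroft 2022); §2 NEW AS TYPED,
elementary.  The matching subcritical UPPER bound `(C/r)e^{−c(p_c−p)r}` (Hutchcroft Prop 4.1, skinny-cluster argument) is NOT treated.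
NO rate, NO exponent for `d = 3`; (T1)/(T2) and the lane's honest sentence UNCHANGED.

References: G. Kozma, A. Nachmias, Invent. Math. 178 (2009) Thm 1.2(ii) [KozmaNachmias2009]; T. Hutchcroft, PLMS 125 (2022) Lemma 2.1,
Prop. 4.1–4.2 [Hutchcroft2022SlightlySupercritical]; M. Heydenreich, R. van der Hofstad (2017) Thm 11.5 [HeydenreichVanDerHofstad2017].
-/

noncomputable section

namespace Summit.CriticalPhenomena.PercolationContinuityZ3.Theorems

open MeasureTheory Set Filter Topology Literature.Probability.Percolation Literature.Probability.LatticeModels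
open Literature.Probability.Percolation.Chemical Literature.Probability.FitznerVanDerHofstad2017
open scoped Classical

namespace ChemRad

variable {d : ℕ}

/-! ### §1. `Γ_p(r) ≤ C/r` uniformly in `p ≤ p_c` under the triangle condition -/

/-- **Kozma–Nachmias' chemical one-arm bound, uniformly below `p_c`**: under the triangle condition there is `C > 0` with
`Γ_p(r) = armSup d p r ≤ C/r` for every `p ≤ p_c` and `r ≥ 1` (the volume tail at `p` is at most the critical one, and the thin-layer
recursion runs at every `p`). [cite: KozmaNachmias2009, §1.3 Thm. 1.2(ii)] [cite: Hutchcroft2022SlightlySupercritical, Lemma 2.1 (proof, first display)] -/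
theorem armSup_le_of_triangle_subcritical (hd : 2 ≤ d) (hT : TriangleCondition d) :
    ∃ C : ℝ, 0 < C ∧ ∀ p : unitInterval, (p : ℝ) ≤ criticalProbI d → ∀ r : ℕ, 1 ≤ r →
      armSup d p r ≤ C / r := by
  obtain ⟨-, -, -, A, hA⟩ := exponents_of_triangle hd hT
  -- the critical volume tail bounds the volume tail at every `p ≤ p_c`
  have hvol : ∀ p : unitInterval, (p : ℝ) ≤ criticalProbI d → ∀ k : ℕ, 1 ≤ k →
      (bondPercolation (zdGraph d) p).real (clusterSizeGe (0 : Site d) k) ≤ A * (k : ℝ) ^ (-(1 / 2 : ℝ)) := by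
    intro p hp k hk
    have h := hA k hk
    rw [Real.sqrt_eq_rpow, div_eq_mul_inv, ← Real.rpow_neg (Nat.cast_nonneg k)] at h
    exact (GhostExploration.real_clusterSizeGe_mono_param (show p ≤ criticalProbI d from hp) 0 k).trans h
  have hA0 : 0 ≤ A := by
    have h1 := hvol (criticalProbI d) le_rfl 1 le_rfl
    have huniv : (bondPercolation (zdGraph d) (criticalProbI d)).real (clusterSizeGe (0 : Site d) 1) = 1 := by
      have : clusterSizeGe (0 : Site d) 1 = (Set.univ : Set (BondConfig (Site d))) := by
        ext ω
        simp only [mem_clusterSizeGe, Nat.cast_one, Set.mem_univ, iff_true, Set.one_le_encard_iff_nonempty]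
        exact ⟨0, mem_openCluster_self _ _⟩
      rw [this, probReal_univ]
    rw [huniv] at h1
    have : (1 : ℝ) ≤ A := by simpa using h1
    linarith
  -- the UNIFORM envelope `Γ*(r) = sup_{p ≤ p_c} Γ_p(r)` satisfies the same recursion
  let I := {q : unitInterval // (q : ℝ) ≤ criticalProbI d}
  haveI : Nonempty I := ⟨⟨criticalProbI d, le_rfl⟩⟩
  let Γ : ℕ → ℝ := fun r => ⨆ q : I, armSup d q.1 r
  have hbdd : ∀ r, BddAbove (Set.range fun q : I => armSup d q.1 r) :=
    fun r => ⟨1, by rintro _ ⟨q, rfl⟩; exact armSup_le_one d q.1 r⟩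
  have hle : ∀ (q : I) r, armSup d q.1 r ≤ Γ r := fun q r => le_ciSup (hbdd r) q
  have h0 : ∀ r, 0 ≤ Γ r := fun r => (armSup_nonneg d (criticalProbI d) r).trans (hle ⟨criticalProbI d, le_rfl⟩ r)
  have h1 : ∀ r, Γ r ≤ 1 := fun r => ciSup_le fun q => armSup_le_one d q.1 r
  have hanti : Antitone Γ := fun r r' hrr' => ciSup_le fun q => (armSup_antitone d q.1 hrr').trans (hle q r)
  have hrec : ∀ m : ℕ, 1 ≤ m → ∀ V : ℝ, 0 < V → Γ (3 * m) ≤ V / m * Γ m ^ 2 + A * V ^ (-(1 / 2 : ℝ)) := by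
    intro m hm V hV
    refine ciSup_le fun q => (armSup_three_mul_le d q.1 hm hV).trans (add_le_add ?_ ?_)
    · exact mul_le_mul_of_nonneg_left (pow_le_pow_left₀ (armSup_nonneg d q.1 m) (hle q m) 2) (by positivity)
    · refine (hvol q.1 q.2 _ (by omega)).trans (mul_le_mul_of_nonneg_left ?_ hA0)
      have hVle : V ≤ ((⌊V⌋₊ + 1 : ℕ) : ℝ) := by push_cast; exact (Nat.lt_floor_add_one V).le
      exact Real.rpow_le_rpow_of_nonpos hV hVle (by norm_num)
  obtain ⟨C, hC, hΓ⟩ := Quant.chemicalRecursion_powerLaw h0 h1 hanti (by norm_num : (0 : ℝ) < 1 / 2)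
    (by norm_num : (1 / 2 : ℝ) < 1) hA0 hrec
  refine ⟨C, hC, fun p hp r hr => ?_⟩
  have h := (hle ⟨p, hp⟩ r).trans (hΓ r hr)
  have hexp : -((1 / 2 : ℝ) / (1 - 1 / 2)) = -1 := by norm_num
  rwa [hexp, Real.rpow_neg_one, ← div_eq_mul_inv] at h

/-- **`P_p(Rad_int(C(0)) ≥ r) ≤ C/r` uniformly in `p ≤ p_c`** under the triangle condition (the lattice event is one of the events in
Kozma–Nachmias' supremum). [cite: KozmaNachmias2009, §1.3 Thm. 1.2(ii)] -/
theorem real_far_le_of_triangle_subcritical (hd : 2 ≤ d) (hT : TriangleCondition d) :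
    ∃ C : ℝ, 0 < C ∧ ∀ p : unitInterval, (p : ℝ) ≤ criticalProbI d → ∀ r : ℕ, 1 ≤ r →
      (bondPercolation (zdGraph d) p).real (far (zdGraph d) (0 : Site d) r) ≤ C / r := by
  obtain ⟨C, hC, h⟩ := armSup_le_of_triangle_subcritical hd hT
  exact ⟨C, hC, fun p hp r hr => (real_far_le_armSup le_rfl p 0 r).trans (h p hp r hr)⟩

/-! ### §2. The subcritical LINEAR window: `P_p(Rad_int ≥ r) ≍ 1/r` for `r(p_c − p) ≤ p` -/

/-- `(p/p_c)^r ≥ e^{-1}` inside the subcritical window `r(p_c − p) ≤ p` (`0 < p ≤ p_c`). [folklore] -/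
theorem exp_neg_one_le_div_pow_of_window {p pc : ℝ} (hp0 : 0 < p) (hppc : p ≤ pc) {r : ℕ}
    (hwin : (r : ℝ) * (pc - p) ≤ p) : Real.exp (-1) ≤ (p / pc) ^ r := by
  have hpc0 : 0 < pc := hp0.trans_le hppc
  rw [← Real.exp_log (pow_pos (div_pos hp0 hpc0) r), Real.exp_le_exp, Real.log_pow, Real.log_div hp0.ne' hpc0.ne']
  have hlog : Real.log pc - Real.log p ≤ (pc - p) / p := by
    rw [← Real.log_div hpc0.ne' hp0.ne']
    have := Real.log_le_sub_one_of_pos (div_pos hpc0 hp0)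
    rw [div_sub_one hp0.ne'] at this
    exact this
  have hr : (0 : ℝ) ≤ r := Nat.cast_nonneg r
  have h1 : (r : ℝ) * ((pc - p) / p) ≤ 1 := by
    rw [mul_div_assoc', div_le_one hp0]; exact hwin
  nlinarith [mul_le_mul_of_nonneg_left hlog hr]

/-- **THE SUBCRITICAL SIDE OF THE CHEMICAL WINDOW, two-sided under the triangle condition**: for `0 < p ≤ p_c`, `r ≥ 1` with
`r(p_c − p) ≤ p`: `1/(e²(r+3)) ≤ P_p(Rad_int(C(0)) ≥ r) ≤ C/r` (lower half hypothesis-free: file 3's `(p/p_c)^r/(e(r+3))`).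
[cite: Hutchcroft2022SlightlySupercritical, Lemma 2.1, Prop. 4.2] [cite: KozmaNachmias2009, §1.3 Thm. 1.2(ii)] -/
theorem real_far_subcrit_window_two_sided_of_triangle (hd : 2 ≤ d) (hT : TriangleCondition d) :
    ∃ C : ℝ, 0 < C ∧ ∀ p : unitInterval, 0 < (p : ℝ) → (p : ℝ) ≤ criticalProbI d → ∀ r : ℕ, 1 ≤ r →
      (r : ℝ) * ((criticalProbI d : ℝ) - p) ≤ p →
        1 / (Real.exp 1 ^ 2 * (r + 3)) ≤ (bondPercolation (zdGraph d) p).real (far (zdGraph d) (0 : Site d) r) ∧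
        (bondPercolation (zdGraph d) p).real (far (zdGraph d) (0 : Site d) r) ≤ C / r := by
  obtain ⟨C, hC, hup⟩ := real_far_le_of_triangle_subcritical hd hT
  refine ⟨C, hC, fun p hp0 hpc r hr hwin => ⟨?_, hup p hpc r hr⟩⟩
  have hlow := real_far_subcritical_ge hd r p hp0 hpc
  have hwin' := exp_neg_one_le_div_pow_of_window hp0 hpc hwin
  refine le_trans ?_ hlow
  calc 1 / (Real.exp 1 ^ 2 * ((r : ℝ) + 3)) = Real.exp (-1) / (Real.exp 1 * (r + 3)) := by
        rw [Real.exp_neg]; field_simp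
    _ ≤ ((p : ℝ) / criticalProbI d) ^ r / (Real.exp 1 * (r + 3)) := div_le_div_of_nonneg_right hwin' (by positivity)

/-- **HIGH DIMENSIONS, unconditionally: `∃ D > 6, ∀ d ≥ D`, the subcritical chemical window is two-sided `≍ 1/r`**
(`1/(e²(r+3)) ≤ P_p(Rad_int(C(0)) ≥ r) ≤ C_d/r` whenever `0 < p ≤ p_c`, `r ≥ 1`, `r(p_c−p) ≤ p`).
[cite: KozmaNachmias2009, §1.3 Thm. 1.2(ii)] [cite: Hutchcroft2022SlightlySupercritical, Prop. 4.2] -/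
theorem real_far_subcrit_window_two_sided_high_dim :
    ∃ D : ℕ, 6 < D ∧ ∀ d : ℕ, D ≤ d → ∃ C : ℝ, 0 < C ∧ ∀ p : unitInterval, 0 < (p : ℝ) → (p : ℝ) ≤ criticalProbI d →
      ∀ r : ℕ, 1 ≤ r → (r : ℝ) * ((criticalProbI d : ℝ) - p) ≤ p →
        1 / (Real.exp 1 ^ 2 * (r + 3)) ≤ (bondPercolation (zdGraph d) p).real (far (zdGraph d) (0 : Site d) r) ∧
        (bondPercolation (zdGraph d) p).real (far (zdGraph d) (0 : Site d) r) ≤ C / r := by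
  obtain ⟨D, hD, hT⟩ := Literature.Barriers.CriticalPhenomena.HaraSlade1990_triangleCondition_holds
  exact ⟨D, hD, fun d hd => real_far_subcrit_window_two_sided_of_triangle (by omega) (hT d hd)⟩

end ChemRad

end Summit.CriticalPhenomena.PercolationContinuityZ3.Theorems

end
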